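import Mathlib
import Literature.MathematicalPhysics.QuantumFieldTheory.Balaban1983to89.B4Sect5Proof
import Literature.MathematicalPhysics.QuantumFieldTheory.Balaban1983to89.B4Sect5Torus
import Literature.MathematicalPhysics.QuantumFieldTheory.Balaban1983to89.B6FromB4

/-!
# `Balaban1983to89.B6FrameReduction` — the reduction scheme of B6's use sites (S2), (S3), (S5) of "[3], Sect. 5"
over an ARBITRARY FRAME (site set + pseudo-metric), with the theorem of [3] as an engine hypothesis on a CLASS of frames

B6 = T. Bałaban, *Propagators and renormalization transformations for lattice gauge theories. II*, Commun. Math.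
Phys. **96**, 223–250 (1984) [Balaban1984PropagatorsII]; [3] = B4 = T. Bałaban, *Regularity and decay of lattice
Green's functions*, Commun. Math. Phys. **89** (1983) 571–597 [Balaban1983RegularityDecay], Sect. 5 Theorem p. 594.
Quotations read from the ×2 page renders `run/shared/lean/pub/pub-balaban/b2b-balaban-ref1/pages/
1984-cmp96-propagators-rt-II/…-p020-x2.png` (p. 242), `…-p024-x2.png` (p. 246), `…-p027-x2.png` (p. 249),
`…-p028-x2.png` (p. 250) (journal page = PDF page + 222), not from an OCR layer.

CITATION HEADER (lean-in-tree rule 2026-08-18).  Cell `pub-balaban`, unit `b2b-balaban-b06-g4` (paper sub-cell B06,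
gen 4; journal claim B6-S5-FRAME-REDUCTION).  Sibling of `…B6FromB4` (unit pv09-g2: the same scheme over finite
Ω ⊂ ℤ^d, §§2–3 there), `…B6Sect5Closed` (this unit: the ℤ^d scheme with [3] discharged) and `…B4Sect5Proof` (unit
pv23-g3: the PROOF of the Sect. 5 Theorem of [3] for Ω ⊂ ℤ^d) and `…B4Sect5Torus` (unit pv09-g4: the Sect. 5
Theorem over an ARBITRARY finite index set with a pseudo-distance and a lattice-sum PROFILE, `Sect5Uniform K` /
`sect5Uniform_holds`, and on the tori).  Nothing landed is edited; the generic sandwich lemmas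
`B6FromB4.sandwich_decay` / `sandwich_lowerBound` / `sandwich_isSymm` (stated there for positions in any pseudo-metric
space), the ℤ^d engine `B4Sect5Proof.unitLatticeEngine` and the profile theorem `B4Sect5Torus.sect5Uniform_holds`
are used BY NAME.

v1.1 (same unit; after the adversarial cross-read adv1-g14, cell GAPS C-A19-1 / G-A19-1): (α) DOCSTRINGS of `Frame`
and `Engine` now say explicitly that an engine is a HYPOTHESIS PER CLASS and is NOT a consequence of the frame axioms —
G-A19-1 exhibits a class of frames (n zero-distance copies of each site of a segment, allowed by a PSEUDO-metric) on
which (5.6) holds with (1, 3, log 2) for every n while |A_n⁻¹(0, n)| ≥ e^{−√n − 1/√n}/(2n²), so no single (c₁, δ₁)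
serves the class; what an engine needs is a UNIFORM lattice-sum profile sup_x Σ_{y} e^{−aρ(x,y)} ≤ K(a) over the
class.  (β) NEW §5, additive (v1 declarations unchanged): `Frame.idxρ`, `Frame.idxρ_isPseudoDist`,
`hyp56_iff_abstract` (`Hyp56` here IS `B4Sect5Torus.Hyp56` of the index-level pseudo-distance, `Iff.rfl`),
`profileClass N K` (the (frame, region) pairs whose N-component index sets obey the profile K, `B4Sect5Torus.SumBound`),
`engine_of_profile` (KERNEL-CHECKED: an engine on `profileClass N K` for every profile K ≥ 0 on positive rates, from
`B4Sect5Torus.sect5Uniform_holds` with the identity compression), `engine_of_profileBound` (hence on every class with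
such a uniform profile).  The torus frames (ρ = `B4Sect5Torus.tdist`, profile N·K_d by `B4Sect5Torus.trho_sumBound`)
are thereby covered as soon as they are written down as `Frame`s — that instantiation is cell item G-pv09g4-1 /
G-b06g4-1 (unit pv09-g4's claim), deliberately not done in this file.

## What is printed (verbatim) and why a frame

* (S5) p. 249, before (2.153): the integral (2.152) [printed with the label "(1.152)", sic] is taken *"on the whole
  lattice T^{(k)}, or on a subset Λ ⊂ T^{(k)}."*; p. 250: *"C is a short-ranged operator, so C*Δ_kC has the same
  exponential decay as Δ_k. Now we may apply the theory developed in Sect. 5 of [3] on unit lattice operators. It gives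
  us an exponential decay, and all the other properties, for the operator (C*Δ_kC)⁻¹, hence for C^{(k)}_Λ also."*
* (S2) p. 242: *"From the theorem on unit lattice operators in [3] it follows that a covariance C′^{(j)}_Λ of the last
  Gaussian integrals in (2.106) is a bounded operator with an exponential decay independent of j and Λ."*
* (S3) p. 246: *"This implies that a covariance C̃^{(j)}_Λ of the Gaussian integral in (2.119) is bounded from above by
  a positive constant dependent on d and L only, and it has an exponential decay with a decay rate having the same
  property."*

The theorem of [3] is printed for finite Ω ⊂ Z^d (B4 p. 594, `B4.Hyp56` / `B4.Sect5ThmUniform`), and so are the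
landed use-site modules (`B6FromB4.Reduction`, `B6BondElimination`, typing remark "T^{(j)}-tori ↦ ℤ^d").  At (S5) with
Λ = the whole lattice T^{(k)} — a TORUS — [3] is used on an index set that is not a subset of ℤ^d with its distance
(cell census GAPS G-pv09g2-1 (vi)).  This module separates the two things the sentence of p. 250 uses: (a) the
carrier-independent REDUCTION SCHEME (sandwich C*Δ_kC, lower bound on the range of C, inverse, sandwich back), which
needs of the sites only a pseudo-metric ρ (ρ(x,x) = 0, symmetric, triangle inequality); (b) the theorem of [3] itself,
which enters as an ENGINE HYPOTHESIS on a CLASS of frames — for all (γ₀, c₀, δ₀) there are (c₁, δ₁) such that for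
every frame of the class, every finite Ω′ and every A with (5.6)_ρ, the inverse has (5.7)_ρ-decay — so that ONE pair
(c, δ) serves the whole class (all torus sizes at once, "independent of j and Λ").  For the class {ℤ^d with the
sup-distance} the engine is PROVED here from `B4Sect5Proof` (§4), recovering `B6FromB4.reductions_uniform`; for the
torus frames the engine is the torus form of [3], which is NOT proved in this file (cell claim G-pv09g2-1-vi-KERNEL,
another unit) — it plugs into `reductions_uniform` below by `Engine`'s definition, nothing else being needed.

## Kernel-checked here (no `sorry`; axioms ⊆ {propext, Classical.choice, Quot.sound})

§1 `Frame`, `Frame.pms` (the pseudo-metric space a frame generates), `Frame.Idx`, `Hyp56`, `InvDecay`, `Engine`,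
`Engine.mono`.  §2 `hyp56_sandwich` ((5.6)_ρ for C*ΔC with (γ, c₀e^{2δ₀r}m², δ₀)), `decay_2156` (decay of
C(C*ΔC)⁻¹C* from that of (C*ΔC)⁻¹).  §3 `Reduction`, `Reduction.cov` ((2.156) *"C^{(k)}_Λ = C(C*Δ_kC)⁻¹C*"*),
`Reduction.Printed` (the printed-shape inputs w.r.t. ρ), `reductions_uniform` (engine on a class ⇒ ONE (c, δ) for
every reduction over every frame of the class).  §4 `zd` (the frame ℤ^d), `hyp56_zd_iff` / `invDecay_zd_iff`
(`Iff.rfl` with `B4.Hyp56` / `B6FromB4.InvDecay`), `engine_zd` (from `B4Sect5Proof.unitLatticeEngine`),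
`ofZd` / `printed_ofZd` (a `B6FromB4.Reduction` is a reduction over the frame ℤ^d with the same printed inputs),
`reductions_zdFrame` (the ℤ^d instance of `reductions_uniform`, unconditionally; via the dictionary it is the
statement of `B6Sect5Closed.reductions`, not restated).  §5 (v1.1) `Frame.idxρ`, `Frame.idxρ_isPseudoDist`,
`hyp56_iff_abstract`, `profileClass`, `engine_of_profile`, `engine_of_profileBound`.

## Typing remarks / scope

(i) Indices are Ω × Fin N with Ω a finite subset of the frame's site type, as in `B4.Idx`; sub-regions
*"or on a subset Λ ⊂ T^{(k)}"* are just other finite subsets of the same frame.  (ii) `Reduction.Printed` keeps as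
hypotheses exactly what `B6FromB4.Reduction.Printed` keeps (the printed lower bounds (2.110)/p. 246/(2.153) on the
range of C, the asserted decay and symmetry of Δ, the short range and ℓ¹ bounds of C, ‖CB′‖ ≥ ‖B′‖); on ℤ^d the
bond-elimination matrix C of p. 250 with these properties is CONSTRUCTED in `…B6BondElimination` — its torus
counterpart is not typed here.  (iii) The engine is (5.7) of [3] at Λ = Ω only (what the scheme consumes); *"all the
other properties"* ((5.8), (5.10)) are not transported.  Value = kernel certificate that the use-site scheme is
carrier-independent + the ℤ^d instance unconditionally; NOT summit progress.
-/

open Finset Matrix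

namespace Literature.MathematicalPhysics.QuantumFieldTheory.Balaban1983to89.B6FrameReduction

/-! ## §1  Frames, (5.6)/(5.7) over a frame, engines over a class of frames -/

/-- A FRAME: a site type `S` with decidable equality and a bare pseudo-metric `ρ` (ρ(x,x) = 0, symmetric, triangle
inequality) — the only structure of the index set the reduction SCHEME of p. 250 uses.  Instances: ℤ^d with the
sup-distance (`zd`, §4); the tori T^{(k)} of (2.152) with the periodic sup-distance (not constructed here).  WARNING
(v1.1, cell GAPS G-A19-1): these axioms alone do NOT make the theorem of [3] hold uniformly on a class of frames — a
pseudo-metric may put arbitrarily many sites at mutual distance 0 — the theorem (an `Engine`, below) additionally needs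
a uniform lattice-sum profile of the class (`profileClass`, `engine_of_profile`, §5). [folklore] -/
structure Frame : Type 1 where
  /-- the sites -/
  S : Type
  /-- decidable equality of sites (needed for the matrix inverse on `↥Ω × Fin N`) -/
  [decEq : DecidableEq S]
  /-- the pseudo-metric, as a bare function -/
  ρ : S → S → ℝ
  ρ_self : ∀ x, ρ x x = 0
  ρ_comm : ∀ x y, ρ x y = ρ y x
  ρ_triangle : ∀ x y z, ρ x z ≤ ρ x y + ρ y z

namespace Frame

/-- the decidable equality of a frame's sites, as an instance -/
instance instDecidableEqS (F : Frame) : DecidableEq F.S := F.decEq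

variable (F : Frame)

/-- The pseudo-metric space generated by a frame (used only inside proofs, to apply the generic sandwich lemmas of
`…B6FromB4` §2, which are stated for positions in a `PseudoMetricSpace`). [folklore] -/
@[reducible] noncomputable def pms : PseudoMetricSpace F.S where
  dist := F.ρ
  dist_self := F.ρ_self
  dist_comm := F.ρ_comm
  dist_triangle := F.ρ_triangle

/-- The distance of `F.pms` is `F.ρ` (definitionally). [folklore] -/
theorem pms_dist (x y : F.S) : @dist F.S F.pms.toDist x y = F.ρ x y := rfl

/-- A pseudo-metric is non-negative (triangle inequality x, y, x). [folklore] -/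
theorem ρ_nonneg (x y : F.S) : 0 ≤ F.ρ x y := by
  have h := F.ρ_triangle x y x
  rw [F.ρ_self, F.ρ_comm y x] at h
  linarith

/-- Indices: (site of a finite region Ω) × (component), as `B4.Idx`. [folklore] -/
abbrev Idx (Ω : Finset F.S) (N : ℕ) : Type := ↥Ω × Fin N

end Frame

variable {N N' : ℕ}

/-- Condition (5.6) of [3] over a frame: A symmetric, A ≥ γ₀ (as a quadratic form), |A(x,x′)| ≤ c₀e^{−δ₀ρ(x,x′)} —
`B4.Hyp56` with |x − x′| ↦ ρ(x, x′). [cite: Balaban1983RegularityDecay, (5.6) p.594] -/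
def Hyp56 (F : Frame) (Ω : Finset F.S) (A : Matrix (F.Idx Ω N) (F.Idx Ω N) ℝ) (γ₀ c₀ δ₀ : ℝ) : Prop :=
  A.IsSymm ∧
  (∀ v : F.Idx Ω N → ℝ, γ₀ * ∑ p, v p ^ 2 ≤ ∑ p, v p * A.mulVec v p) ∧
  (∀ p q : F.Idx Ω N, |A p q| ≤ c₀ * Real.exp (-(δ₀ * F.ρ (p.1 : F.S) (q.1 : F.S))))

/-- Conclusion (5.7) of [3] at Λ = Ω over a frame: |A⁻¹(x,x′)| ≤ c₁e^{−δ₁ρ(x,x′)} — `B6FromB4.InvDecay` with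
|x − x′| ↦ ρ(x, x′). [cite: Balaban1983RegularityDecay, (5.7) p.594] -/
def InvDecay (F : Frame) (Ω : Finset F.S) (A : Matrix (F.Idx Ω N) (F.Idx Ω N) ℝ) (c₁ δ₁ : ℝ) : Prop :=
  ∀ p q : F.Idx Ω N, |A⁻¹ p q| ≤ c₁ * Real.exp (-(δ₁ * F.ρ (p.1 : F.S) (q.1 : F.S)))

variable (N) in
/-- An ENGINE on a class 𝒞 of instances (frame, region): the Sect. 5 Theorem of [3] in the form the use sites consume it
— constants BEFORE the instance: for all positive (γ₀, c₀, δ₀) there are positive (c₁, δ₁) such that for every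
(F, Ω) in the class and every A with (5.6)_ρ, the inverse satisfies (5.7)_ρ (*"a decay rate δ₁ depending on δ₀ and
the bound γ₀"* p. 237, *"independent of j and Λ"* p. 242).  For 𝒞 = {ℤ^d} this is `B6FromB4.UnitLatticeEngine`
(`engine_zd`); for the tori of (2.152) it is the torus form of [3] (not proved in this file).  An engine is a
HYPOTHESIS PER CLASS, not a consequence of the `Frame` axioms (v1.1, cell GAPS G-A19-1: a class of frames with (5.6)
at fixed (γ₀, c₀, δ₀) and no common (c₁, δ₁)); it is DISCHARGED for every class with a uniform lattice-sum profile
Σ_y e^{−aρ(x,y)} ≤ K(a) by `engine_of_profile` / `engine_of_profileBound` (§5, from `B4Sect5Torus.sect5Uniform_holds`).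
[cite: Balaban1984PropagatorsII, p.242 + p.250] -/
def Engine (𝒞 : (F : Frame) → Finset F.S → Prop) : Prop :=
  ∀ γ₀ c₀ δ₀ : ℝ, 0 < γ₀ → 0 < c₀ → 0 < δ₀ → ∃ c₁ δ₁ : ℝ, 0 < c₁ ∧ 0 < δ₁ ∧
    ∀ (F : Frame) (Ω : Finset F.S), 𝒞 F Ω → ∀ A : Matrix (F.Idx Ω N) (F.Idx Ω N) ℝ,
      Hyp56 F Ω A γ₀ c₀ δ₀ → InvDecay F Ω A c₁ δ₁

/-- An engine on a class is an engine on every subclass. [folklore] -/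
theorem Engine.mono {𝒞 𝒞' : (F : Frame) → Finset F.S → Prop} (h : ∀ F Ω, 𝒞' F Ω → 𝒞 F Ω)
    (hE : Engine N 𝒞) : Engine N 𝒞' := by
  intro γ₀ c₀ δ₀ hγ hc hδ
  obtain ⟨c₁, δ₁, hc₁, hδ₁, H⟩ := hE γ₀ c₀ δ₀ hγ hc hδ
  exact ⟨c₁, δ₁, hc₁, hδ₁, fun F Ω hF A hA => H F Ω (h F Ω hF) A hA⟩

/-! ## §2  The sandwich over a frame: (5.6)_ρ for C*ΔC, and the decay of C(C*ΔC)⁻¹C* -/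

section Sandwich

variable {F : Frame}

/-- KERNEL-CHECKED, p. 250 over a frame: for Δ on the variables Ω × Fin N (entrywise decay (c₀, δ₀) in ρ, symmetric)
and a parametrization B = CB′ by variables Ω′ × Fin N′ (range ≤ r in ρ, column ℓ¹-sums ≤ m, ‖CB′‖ ≥ ‖B′‖) on whose
range ⟨CB′, ΔCB′⟩ ≥ γ‖CB′‖², the reduced operator C*ΔC satisfies (5.6)_ρ on Ω′ with (γ, c₀e^{2δ₀r}m², δ₀): *"C is
a short-ranged operator, so C*Δ_kC has the same exponential decay as Δ_k"* — `B6FromB4.hyp56_sandwich` with ℤ^d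
replaced by the frame (proof: the generic sandwich lemmas of `…B6FromB4` §2 in the pseudo-metric space `F.pms`). [cite: Balaban1984PropagatorsII, (2.157) p.250] -/
theorem hyp56_sandwich {Ω Ω' : Finset F.S}
    (C : Matrix (F.Idx Ω N) (F.Idx Ω' N') ℝ) (Δ : Matrix (F.Idx Ω N) (F.Idx Ω N) ℝ)
    {γ c₀ δ₀ r mC : ℝ} (hγ : 0 ≤ γ) (hc : 0 ≤ c₀) (hδ : 0 ≤ δ₀)
    (hΔs : Δ.IsSymm)
    (hΔd : ∀ p q : F.Idx Ω N, |Δ p q| ≤ c₀ * Real.exp (-(δ₀ * F.ρ (p.1 : F.S) (q.1 : F.S))))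
    (hlow : ∀ w : F.Idx Ω' N' → ℝ,
      γ * ∑ u, (C *ᵥ w) u ^ 2 ≤ ∑ u, (C *ᵥ w) u * (Δ *ᵥ (C *ᵥ w)) u)
    (hiso : ∀ w : F.Idx Ω' N' → ℝ, ∑ k, w k ^ 2 ≤ ∑ u, (C *ᵥ w) u ^ 2)
    (hrange : ∀ p k, C p k ≠ 0 → F.ρ (p.1 : F.S) (k.1 : F.S) ≤ r)
    (hcol : ∀ k, ∑ p, |C p k| ≤ mC) :
    Hyp56 F Ω' (Cᵀ * Δ * C) γ (c₀ * Real.exp (2 * δ₀ * r) * mC * mC) δ₀ := by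
  letI : PseudoMetricSpace F.S := F.pms
  refine ⟨B6FromB4.sandwich_isSymm C hΔs, fun v => B6FromB4.sandwich_lowerBound C Δ hγ hlow hiso v, ?_⟩
  intro p q
  exact B6FromB4.sandwich_decay (fun u : F.Idx Ω N => (u.1 : F.S))
    (fun k : F.Idx Ω' N' => (k.1 : F.S)) Cᵀ Δ C hc hδ
    (fun i u h => by
      rw [dist_comm]
      exact hrange u i (by simpa using h))
    (fun i => by simpa using hcol i) hrange hcol hΔd p q

/-- KERNEL-CHECKED, p. 250 over a frame, *"hence for C^{(k)}_Λ also"*: decay of (C*ΔC)⁻¹ in ρ with (c₁, δ₁) and a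
short-ranged C (range ≤ r, row ℓ¹-sums ≤ m) give the decay of C(C*ΔC)⁻¹C* = (2.156) with (c₁e^{2δ₁r}m², δ₁) —
`B6FromB4.decay_2156` with ℤ^d replaced by the frame. [cite: Balaban1984PropagatorsII, (2.156) p.250] -/
theorem decay_2156 {Ω Ω' : Finset F.S}
    (C : Matrix (F.Idx Ω N) (F.Idx Ω' N') ℝ) (Δ : Matrix (F.Idx Ω N) (F.Idx Ω N) ℝ)
    {c₁ δ₁ r mC : ℝ} (hc₁ : 0 ≤ c₁) (hδ₁ : 0 ≤ δ₁)
    (hI : InvDecay F Ω' (Cᵀ * Δ * C) c₁ δ₁)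
    (hrange : ∀ p k, C p k ≠ 0 → F.ρ (p.1 : F.S) (k.1 : F.S) ≤ r)
    (hrow : ∀ p, ∑ k, |C p k| ≤ mC) :
    ∀ p q : F.Idx Ω N, |(C * (Cᵀ * Δ * C)⁻¹ * Cᵀ) p q| ≤
      c₁ * Real.exp (2 * δ₁ * r) * mC * mC * Real.exp (-(δ₁ * F.ρ (p.1 : F.S) (q.1 : F.S))) := by
  letI : PseudoMetricSpace F.S := F.pms
  intro p q
  exact B6FromB4.sandwich_decay (fun k : F.Idx Ω' N' => (k.1 : F.S))
    (fun u : F.Idx Ω N => (u.1 : F.S)) C (Cᵀ * Δ * C)⁻¹ Cᵀ hc₁ hδ₁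
    hrange hrow
    (fun v k h => by
      rw [dist_comm]
      exact hrange k v (by simpa using h))
    (fun k => by simpa using hrow k) hI p q

end Sandwich

/-! ## §3  The reduction scheme over a frame; ONE (c, δ) for a whole class of frames -/

section Reduced

/-- ONE INSTANCE of the constrained unit-lattice Gaussians of (S2), (S3), (S5) over the frame F: the operator Δ of the
quadratic form on the variables Ω × Fin N and the parametrization B = CB′ of the constrained subspace by the variables
Ω′ × Fin N′ (p. 250: *"If we denote the remaining variables by B′, then we can write B = CB′, where C is a linear
operator"*) — `B6FromB4.Reduction` with ℤ^d replaced by F (at (S5) on T^{(k)}: F = the torus frame; Λ ⊂ T^{(k)}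
*"or on a subset"* = a smaller Ω). [cite: Balaban1984PropagatorsII, (2.154)–(2.156) pp.249–250] -/
structure Reduction (F : Frame) (N N' : ℕ) where
  /-- the sites carrying the variables B (or ω) -/
  Ω : Finset F.S
  /-- the sites carrying the remaining variables B′ -/
  Ω' : Finset F.S
  /-- the operator of the quadratic form -/
  Δ : Matrix (F.Idx Ω N) (F.Idx Ω N) ℝ
  /-- B = CB′ -/
  C : Matrix (F.Idx Ω N) (F.Idx Ω' N') ℝ

variable {F : Frame}

/-- The covariance of the constrained Gaussian, (2.156) verbatim: *"C^{(k)}_Λ = C(C*Δ_kC)⁻¹C*"*. [cite: Balaban1984PropagatorsII, (2.156) p.250] -/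
noncomputable def Reduction.cov (T : Reduction F N N') : Matrix (F.Idx T.Ω N) (F.Idx T.Ω N) ℝ :=
  T.C * (T.Cᵀ * T.Δ * T.C)⁻¹ * T.Cᵀ

/-- The PRINTED-SHAPE inputs of one reduction w.r.t. the frame's ρ, constants (γ, c₀, δ₀, r, m) as parameters —
`B6FromB4.Reduction.Printed` with |x − x′| ↦ ρ(x, x′): Δ symmetric with |Δ(x,x′)| ≤ c₀e^{−δ₀ρ(x,x′)}; the lower
bound γ‖CB′‖² ≤ ⟨CB′, ΔCB′⟩ on the range of C ((2.153)/(2.157): *"⟨B′, C*Δ_kCB′⟩ ≥ (γ₀/12d²)L^{−d−1}‖CB′‖² ≥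
γ′₀‖B′‖²"*; (2.110); p. 246); ‖CB′‖² ≥ ‖B′‖²; C short-ranged (*"C is a short-ranged operator"*) with ℓ¹-bounded rows
and columns.  [cite: Balaban1984PropagatorsII, (2.110) p.242 + p.246 + (2.153)–(2.157) pp.249–250] -/
structure Reduction.Printed (T : Reduction F N N') (γ c₀ δ₀ r mC : ℝ) : Prop where
  symm : T.Δ.IsSymm
  decay : ∀ p q : F.Idx T.Ω N, |T.Δ p q| ≤ c₀ * Real.exp (-(δ₀ * F.ρ (p.1 : F.S) (q.1 : F.S)))
  lower : ∀ w : F.Idx T.Ω' N' → ℝ,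
    γ * ∑ u, (T.C *ᵥ w) u ^ 2 ≤ ∑ u, (T.C *ᵥ w) u * (T.Δ *ᵥ (T.C *ᵥ w)) u
  iso : ∀ w : F.Idx T.Ω' N' → ℝ, ∑ k, w k ^ 2 ≤ ∑ u, (T.C *ᵥ w) u ^ 2
  range : ∀ p k, T.C p k ≠ 0 → F.ρ (p.1 : F.S) (k.1 : F.S) ≤ r
  col : ∀ k, ∑ p, |T.C p k| ≤ mC
  row : ∀ p, ∑ k, |T.C p k| ≤ mC

/-- KERNEL-CHECKED, the assertions of (S2)/(S3)/(S5) over a CLASS of frames: an engine on 𝒞 (the theorem of [3] for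
the frames of 𝒞, constants before the instance) yields ONE c and ONE δ such that EVERY reduction over EVERY frame F,
with (F, Ω′) in 𝒞 and printed-shape inputs with the same (γ, c₀, δ₀, r, m), has |cov(x, x′)| ≤ c·e^{−δρ(x,x′)} —
*"an exponential decay independent of j and Λ"* (p. 242), *"It gives us an exponential decay … for the operator
(C*Δ_kC)⁻¹, hence for C^{(k)}_Λ also"* (p. 250), on the whole lattice T^{(k)} or on a subset alike.  Chain:
`hyp56_sandwich` → engine → `decay_2156`; c = c₁e^{2δ₁r}m², δ = δ₁. [cite: Balaban1984PropagatorsII, p.242 + p.246 + p.250] -/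
theorem reductions_uniform {𝒞 : (F : Frame) → Finset F.S → Prop} (hE : Engine N' 𝒞) {γ c₀ δ₀ r mC : ℝ}
    (hγ : 0 < γ) (hc : 0 < c₀) (hδ : 0 < δ₀) (hm : 0 < mC) :
    ∃ c δ : ℝ, 0 < c ∧ 0 < δ ∧ ∀ (F : Frame) (T : Reduction F N N'), 𝒞 F T.Ω' → T.Printed γ c₀ δ₀ r mC →
      ∀ p q : F.Idx T.Ω N, |T.cov p q| ≤ c * Real.exp (-(δ * F.ρ (p.1 : F.S) (q.1 : F.S))) := by
  have hc' : 0 < c₀ * Real.exp (2 * δ₀ * r) * mC * mC := by positivity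
  obtain ⟨c₁, δ₁, hc₁, hδ₁, H⟩ := hE γ _ δ₀ hγ hc' hδ
  refine ⟨c₁ * Real.exp (2 * δ₁ * r) * mC * mC, δ₁, by positivity, hδ₁, fun F T hT hP p q => ?_⟩
  have h56 := hyp56_sandwich T.C T.Δ hγ.le hc.le hδ.le hP.symm hP.decay hP.lower hP.iso hP.range hP.col
  exact decay_2156 T.C T.Δ hc₁.le hδ₁.le (H F T.Ω' hT _ h56) hP.range hP.row p q

end Reduced

/-! ## §4  The frame ℤ^d: consistency with `B4` / `B6FromB4`, and its engine PROVED from `B4Sect5Proof` -/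

section Zd

variable (d : ℕ)

/-- The frame ℤ^d with the sup-distance |x − x′| = max_μ |x_μ − x′_μ| (Mathlib's `dist` on `Fin d → ℤ`), the setting
of B4 p. 594 and of `B4.Hyp56`. [cite: Balaban1983RegularityDecay, Sect. 5 p.594] -/
noncomputable def zd : Frame where
  S := Fin d → ℤ
  ρ := dist
  ρ_self := dist_self
  ρ_comm := dist_comm
  ρ_triangle := dist_triangle

/-- The pseudo-metric of the frame ℤ^d is Mathlib's sup-distance on `Fin d → ℤ` (definitionally). [folklore] -/
theorem zd_ρ (x y : Fin d → ℤ) : (zd d).ρ x y = dist x y := rfl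

/-- The class consisting of the single frame ℤ^d (every finite region allowed). [folklore] -/
def zdClass : (F : Frame) → Finset F.S → Prop := fun F _ => F = zd d

variable {d}

/-- (5.6) over the frame ℤ^d IS `B4.Hyp56` (definitionally). [folklore] -/
theorem hyp56_zd_iff (Ω : Finset (Fin d → ℤ)) (A : Matrix (B4.Idx Ω N) (B4.Idx Ω N) ℝ) (γ₀ c₀ δ₀ : ℝ) :
    Hyp56 (zd d) Ω A γ₀ c₀ δ₀ ↔ B4.Hyp56 Ω A γ₀ c₀ δ₀ := Iff.rfl

/-- (5.7) at Λ = Ω over the frame ℤ^d IS `B6FromB4.InvDecay` (definitionally). [folklore] -/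
theorem invDecay_zd_iff (Ω : Finset (Fin d → ℤ)) (A : Matrix (B4.Idx Ω N) (B4.Idx Ω N) ℝ) (c₁ δ₁ : ℝ) :
    InvDecay (zd d) Ω A c₁ δ₁ ↔ B6FromB4.InvDecay Ω A c₁ δ₁ := Iff.rfl

/-- KERNEL-CHECKED: the engine on the class {ℤ^d} HOLDS — it is `B6FromB4.UnitLatticeEngine d N`, proved in
`B4Sect5Proof.unitLatticeEngine` from the Sect. 5 Theorem of [3] (`B4Sect5Proof.sect5ThmUniform_holds`). [cite: Balaban1983RegularityDecay, Sect. 5 Theorem p.594 + p.597] -/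
theorem engine_zd (d M : ℕ) : Engine M (zdClass d) := by
  intro γ₀ c₀ δ₀ hγ hc hδ
  obtain ⟨c₁, δ₁, hc₁, hδ₁, H⟩ := B4Sect5Proof.unitLatticeEngine d M γ₀ c₀ δ₀ hγ hc hδ
  refine ⟨c₁, δ₁, hc₁, hδ₁, ?_⟩
  intro F Ω hF A hA
  dsimp only [zdClass] at hF
  subst hF
  exact H Ω A hA

/-- A `B6FromB4.Reduction` (over ℤ^d) read as a reduction over the frame ℤ^d. [folklore] -/
def ofZd (T : B6FromB4.Reduction d N N') : Reduction (zd d) N N' :=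
  ⟨T.Ω, T.Ω', T.Δ, T.C⟩

/-- Its printed-shape inputs are the same propositions. [folklore] -/
theorem printed_ofZd {T : B6FromB4.Reduction d N N'} {γ c₀ δ₀ r mC : ℝ} (h : T.Printed γ c₀ δ₀ r mC) :
    (ofZd T).Printed γ c₀ δ₀ r mC :=
  ⟨h.symm, h.decay, h.lower, h.iso, h.range, h.col, h.row⟩

/-- KERNEL-CHECKED, the ℤ^d INSTANCE of `reductions_uniform` with the proved engine `engine_zd`: ONE (c, δ) for
every reduction over the frame ℤ^d — unconditionally ((zd d).ρ = the sup-distance `dist` of `Fin d → ℤ`, `zd_ρ`).  Through the dictionary `ofZd` / `printed_ofZd` this is the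
statement of `B6Sect5Closed.reductions` (= `B6FromB4.reductions_uniform` with [3] discharged), which is therefore not
restated here. [cite: Balaban1984PropagatorsII, p.242 + p.246 + p.250] -/
theorem reductions_zdFrame {γ c₀ δ₀ r mC : ℝ} (hγ : 0 < γ) (hc : 0 < c₀) (hδ : 0 < δ₀) (hm : 0 < mC) :
    ∃ c δ : ℝ, 0 < c ∧ 0 < δ ∧ ∀ T : Reduction (zd d) N N', T.Printed γ c₀ δ₀ r mC →
      ∀ p q : (zd d).Idx T.Ω N,
        |T.cov p q| ≤ c * Real.exp (-(δ * (zd d).ρ (p.1 : (zd d).S) (q.1 : (zd d).S))) := by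
  obtain ⟨c, δ, hc0, hδ0, H⟩ := reductions_uniform (N := N) (engine_zd d N') hγ hc hδ hm
  exact ⟨c, δ, hc0, hδ0, fun T hT p q => H (zd d) T rfl hT p q⟩

end Zd

/-! ## §5  (v1.1) Engines from a uniform lattice-sum profile — the generalised Sect. 5 Theorem of `…B4Sect5Torus` -/

section Profile

/-- The index-level pseudo-distance of a region of a frame: ρ of the underlying sites (components ignored), the `ρ`
argument of `B4Sect5Torus.Hyp56` / `SumBound`. [folklore] -/
def Frame.idxρ (F : Frame) (Ω : Finset F.S) (N : ℕ) : F.Idx Ω N → F.Idx Ω N → ℝ :=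
  fun p q => F.ρ (p.1 : F.S) (q.1 : F.S)

/-- It is a pseudo-distance in the sense of `B4Sect5Torus.IsPseudoDist`. [folklore] -/
theorem Frame.idxρ_isPseudoDist (F : Frame) (Ω : Finset F.S) (N : ℕ) :
    B4Sect5Torus.IsPseudoDist (F.idxρ Ω N) :=
  ⟨fun _ _ => F.ρ_comm _ _, fun _ => F.ρ_self _, fun _ _ _ => F.ρ_triangle _ _ _⟩

/-- (5.6) over a frame IS the abstract (5.6) of `…B4Sect5Torus` for the index-level pseudo-distance (definitionally).
[folklore] -/
theorem hyp56_iff_abstract (F : Frame) (Ω : Finset F.S) (A : Matrix (F.Idx Ω N) (F.Idx Ω N) ℝ)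
    (γ₀ c₀ δ₀ : ℝ) : Hyp56 F Ω A γ₀ c₀ δ₀ ↔ B4Sect5Torus.Hyp56 (F.idxρ Ω N) A γ₀ c₀ δ₀ :=
  Iff.rfl

variable (N) in
/-- The class of (frame, region) pairs whose N-component index sets obey the lattice-sum PROFILE K:
Σ_q e^{−aρ(p,q)} ≤ K(a) for every rate a > 0 and every index p (`B4Sect5Torus.SumBound`).  ℤ^d regions and torus
regions have the profile K(a) = N·K_d(a) (`B4Sect5Proof.idxSum_le`, `B4Sect5Torus.trho_sumBound`). [folklore] -/
def profileClass (K : ℝ → ℝ) : (F : Frame) → Finset F.S → Prop :=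
  fun F Ω => B4Sect5Torus.SumBound (F.idxρ Ω N) K

variable (N) in
/-- KERNEL-CHECKED (v1.1): **an engine on every profile class** — for every profile K, nonnegative on positive rates,
the Sect. 5 Theorem of [3] in its generalised, kernel-proved form `B4Sect5Torus.sect5Uniform_holds K` (arbitrary
finite index set + pseudo-distance + profile; identity compression, conclusion (5.7)) IS an `Engine N (profileClass N K)`:
one (c₁, δ₁) for every frame and region of the class.  This is the input the frame axioms alone cannot supply
(cell GAPS G-A19-1). [cite: Balaban1983RegularityDecay, Sect. 5 Theorem p.594 + p.597] -/
theorem engine_of_profile (K : ℝ → ℝ) (hK : ∀ a, 0 < a → 0 ≤ K a) : Engine N (profileClass N K) := by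
  intro γ₀ c₀ δ₀ hγ hc hδ
  obtain ⟨c₁, δ₁, hc₁, hδ₁, H⟩ := B4Sect5Torus.sect5Uniform_holds K hK γ₀ c₀ δ₀ hγ hc hδ
  refine ⟨c₁, δ₁, hc₁, hδ₁, fun F Ω hΩ A hA p q => ?_⟩
  have h1 := (H (F.Idx Ω N) (F.idxρ Ω N) (F.idxρ_isPseudoDist Ω N) hΩ A
    ((hyp56_iff_abstract F Ω A γ₀ c₀ δ₀).1 hA) (F.Idx Ω N) id Function.injective_id).1 p q
  simpa [Matrix.submatrix_id_id, Frame.idxρ] using h1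

/-- KERNEL-CHECKED (v1.1): hence an engine on EVERY class carrying a uniform profile (`Engine.mono`). [folklore] -/
theorem engine_of_profileBound {𝒞 : (F : Frame) → Finset F.S → Prop} {K : ℝ → ℝ} (hK : ∀ a, 0 < a → 0 ≤ K a)
    (h𝒞 : ∀ (F : Frame) (Ω : Finset F.S), 𝒞 F Ω → B4Sect5Torus.SumBound (F.idxρ Ω N) K) : Engine N 𝒞 :=
  Engine.mono h𝒞 (engine_of_profile N K hK)

end Profile

end Literature.MathematicalPhysics.QuantumFieldTheory.Balaban1983to89.B6FrameReduction
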